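import Literature.NumberTheory.EllipticCurves.ModularJacobianGaloisCharpolyRel
import Mathlib.FieldTheory.IsAlgClosed.AlgebraicClosure
import HarnessLib

/-!
# Buzzard 2000 Prop. 2.4 from the Eichler–Shimura congruence relation and the `J₁(N)` input

The cited input `buzzard2000_multiplicityOne_gamma0` (Buzzard 2000 [Buzzard2000LevelLoweringModTwo]
Prop. 2.4: `dim_{𝕋/𝔪} J₀(N)[𝔪] = 2` at odd level for `ρ_𝔪` irreducible and non-scalar on `D₂`)
reduced to its two printed inputs that the tree does not prove:

1. **Eichler–Shimura, Galois form** — `nonempty_modularJacobianGaloisData_eichlerShimura`, a named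
   fact stated on the tree's interface `ModularJacobianGaloisData N ι` for the `ℚ`-structure of the
   modular Jacobian (`AlgebraicModularParametrizationWithShift.lean`; bare existence is the cited
   `nonempty_modularJacobianGaloisData`): there is such a datum whose Galois action satisfies
   `φ² - T_p φ + p = 0` on the prime-to-`p` torsion of `J₀(N)` for every arithmetic Frobenius `φ`
   above a prime `p ∤ N` (Darmon–Diamond–Taylor [DarmonDiamondTaylor1995] Thm. 1.29, p. 37:
   "`T_p = F + ⟨p⟩F'` on `J_Γ/𝔽_p`", transported to Galois action on torsion points through good
   reduction as in the proof of their Thm. 3.1(a), p. 86; Shimura [ShimuraIATAF1971] Thm. 7.9).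
2. **The `J₁(N)` input** (hypothesis `hJ₁`, NOT a named fact here because its honest statement needs
   the `J₁(N)` carrier the tree lacks): for the `𝕋/𝔪`-linear Galois representation `σ` on
   `J0 N[𝔪]`, a `σ`-stable subspace `U` on which `Γ_ℚ` acts through an abelian quotient with
   `dim (J0 N[𝔪] ⧸ U) ≤ 2` — in print `U = J₀(N)[𝔪] ∩ ker(J₀(N) → J₁(N))`, abelian by Buzzard's
   Lemma 2.3 (⟸ Ling–Oesterlé Prop. 6), of codimension `≤ 2` because `J₁(N)[𝔪]` is
   `2`-dimensional (Buzzard's appendix to Ribet–Stein [RibetStein2008], Thm. 6.1 ⟸ Edixhoven 1992).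

Everything else in the printed proof is kernel: the `𝕋/𝔪`-linear Galois action on `J0 N[𝔪]` with
open kernel, Chebotarev, the Boston–Lenstra–Ribet relations and theorem, Burnside, the residue-field
descent, the multiplicity count and `J₀(N)[𝔪] ≠ 0` (`ModularJacobianGaloisCharpolyRel.lean`,
`ModularJacobianMultiplicityOneOfGaloisDatum.lean`, `Algebra/GroupRings/CharpolyQuotientRankTwo*`,
`ModularJacobianTorsionNonvanishing.lean`, `GaloisRepresentations/ChebotarevOpenSubgroup.lean`).

HONESTY: a reduction. Input 1 is a cited, unproved fact; input 2 is a hypothesis; the fact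
`buzzard2000_multiplicityOne_gamma0` remains a cited input of its consumers; no summit statement
(BirchSwinnertonDyer) is proved by this file.
-/

noncomputable section

open scoped MatrixGroups ModularForm NumberField

open CongruenceSubgroup Polynomial IsDedekindDomain

namespace Literature.NumberTheory.EllipticCurves.ModularForms

open GaloisRepresentations Rat.HeightOneSpectrum

/-- **Eichler–Shimura congruence relation on the torsion of `J₀(N)`, Galois form** (named fact).
Darmon–Diamond–Taylor, *Fermat's Last Theorem*, Thm. 1.29 (p. 37): "If `p ∤ N` then the
endomorphism `T_p` of `J_Γ/𝔽_p` satisfies `T_p = F + ⟨p⟩F'`" (`F` the Frobenius endomorphism,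
`F'` its dual, `FF' = F'F = p`; for `Γ = Γ₀(N)` the diamond operator is trivial), together with the
passage to Galois action on torsion points in the proof of their Thm. 3.1(a) (p. 86): "`J₁(N)` has
good reduction at primes `p` not dividing `N`. So the action of `G_p` on `T_ℓ` … is unramified and
is in fact described by the action of `Frob_p` on the Tate module of the reduction. But this is
given by the Frobenius endomorphism `F`"; Shimura, *Introduction to the arithmetic theory of
automorphic functions*, Thm. 7.9. Read on the tree's carriers: for every level `N ≥ 1` and embedding
`ι : ℚ̄ → ℂ` there is a `ℚ`-structure datum `D : ModularJacobianGaloisData N ι` (the interface of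
`AlgebraicModularParametrizationWithShift.lean`; bare existence is `nonempty_modularJacobianGaloisData`)
such that for every prime `p ∤ N`, every prime `𝔓` of `\bar ℤ` above `p`, every arithmetic
Frobenius `φ ∈ Γ_ℚ` at `𝔓`, and every torsion point `x` of `J₀(N)(ℂ)` killed by some `m` with
`p ∤ m`: `φ(φ x) - T_p (φ x) + p x = 0` (since `F² - T_p F + p = F² - (F + F')F + p = 0` on the
reduction, whose prime-to-`p` torsion is identified `D_𝔓`-equivariantly with that of `J₀(N)(ℚ̄)`,
inertia acting trivially). Not proved here (no `X₀(N)` over `ℤ[1/N]` in the tree).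
[cite: DarmonDiamondTaylor1995, Thm. 1.29 (p. 37) with the proof of Thm. 3.1(a) (p. 86)]
[cite: ShimuraIATAF1971, Thm. 7.9] [file NumberTheory/EllipticCurves/ModularJacobianGaloisDataExists] -/
def nonempty_modularJacobianGaloisData_eichlerShimura : Prop :=
  ∀ (N : ℕ) [NeZero N] (ι : AlgebraicClosure ℚ →+* ℂ), ∃ D : ModularJacobianGaloisData N ι,
    ∀ v : HeightOneSpectrum (𝓞 ℚ), ¬ ((primesEquiv v : Nat.Primes) : ℕ) ∣ N →
    ∀ 𝔓 ∈ v.primesAbove, ∀ φ : Field.absoluteGaloisGroup ℚ, IsArithFrobAt (𝓞 ℚ) φ 𝔓 →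
    ∀ m : ℕ, ¬ ((primesEquiv v : Nat.Primes) : ℕ) ∣ m →
    ∀ x : J0.tors N, (m : HeckeRing0 N 2) • x = 0 →
      D.galAct φ (D.galAct φ x)
        - (HeckeRing0.T N 2 ((primesEquiv v : Nat.Primes) : ℕ) (primesEquiv v : Nat.Primes).2)
            • D.galAct φ x
        + (((primesEquiv v : Nat.Primes) : ℕ) : HeckeRing0 N 2) • x = 0

/-- **Buzzard 2000 Prop. 2.4 (`buzzard2000_multiplicityOne_gamma0`) from Eichler–Shimura and the
`J₁(N)` input.** Hypotheses: (1) the named fact `nonempty_modularJacobianGaloisData_eichlerShimura`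
(Darmon–Diamond–Taylor Thm. 1.29 in Galois form); (2) `hJ₁`: for every instance of the fact's
binders and hypotheses, every Galois datum `D` satisfying Eichler–Shimura on `J₀(N)[2]` above
`p ∤ 2N`, and the `𝕋/𝔪`-linear representation `σ` on `J0 N[𝔪]` agreeing with `D.galAct`, a
`σ`-stable subspace `U ≤ J0 N[𝔪]` with commuting action and `dim (J0 N[𝔪] ⧸ U) ≤ 2` (print:
Buzzard's Lemma 2.3 ⟸ Ling–Oesterlé, and Thm. 6.1 of his appendix to Ribet–Stein on `J₁(N)`).
Conclusion: the cited fact. Proof: `buzzard2000_multiplicityOne_gamma0_of_galoisData` with the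
datum of (1) at the embedding `IsAlgClosed.lift : ℚ̄ → ℂ`. A reduction, not a proof of the input.
[cite: Buzzard2000LevelLoweringModTwo, Lemma 2.3 and proof of Prop. 2.4 (p. 101)] -/
theorem buzzard2000_multiplicityOne_gamma0_of_eichlerShimura
    (hES : nonempty_modularJacobianGaloisData_eichlerShimura)
    (hJ₁ : ∀ (N : ℕ) [NeZero N], Odd N →
      ∀ (𝔪 : Ideal (HeckeRing0 N 2)), 𝔪.IsMaximal → (2 : HeckeRing0 N 2) ∈ 𝔪 →
      ∀ (k : Type) [Field k] [IsAlgClosed k] [TopologicalSpace k] [DiscreteTopology k]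
        (ι : HeckeRing0 N 2 ⧸ 𝔪 →+* k) (ρ : ModPGaloisRep ℚ k 2),
        (∀ v : HeightOneSpectrum (𝓞 ℚ), ¬ ((primesEquiv v : Nat.Primes) : ℕ) ∣ 2 * N →
          ρ.IsUnramifiedAt v ∧
            ρ.HasFrobCharpolyAt v
              (X ^ 2
                - C (ι (Ideal.Quotient.mk 𝔪 (HeckeRing0.T N 2
                    ((primesEquiv v : Nat.Primes) : ℕ) (primesEquiv v : Nat.Primes).2))) * X
                + C (((primesEquiv v : Nat.Primes) : ℕ) : k))) →
        FramedRep.IsIrreducible ρ →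
        (∀ v : HeightOneSpectrum (𝓞 ℚ), ((primesEquiv v : Nat.Primes) : ℕ) = 2 →
          ∀ 𝔓 ∈ v.primesAbove, ∃ σ ∈ 𝔓.decompositionSubgroup (Field.absoluteGaloisGroup ℚ),
            ∀ c : k, ((ρ σ : GL (Fin 2) k) : Matrix (Fin 2) (Fin 2) k) ≠ Matrix.scalar (Fin 2) c) →
        ∀ (ιℂ : AlgebraicClosure ℚ →+* ℂ) (D : ModularJacobianGaloisData N ιℂ),
          (∀ v : HeightOneSpectrum (𝓞 ℚ), ¬ ((primesEquiv v : Nat.Primes) : ℕ) ∣ 2 * N →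
            ∀ 𝔓 ∈ v.primesAbove, ∀ φ : Field.absoluteGaloisGroup ℚ, IsArithFrobAt (𝓞 ℚ) φ 𝔓 →
            ∀ x : J0.tors N, (2 : HeckeRing0 N 2) • x = 0 →
              D.galAct φ (D.galAct φ x)
                - (HeckeRing0.T N 2 ((primesEquiv v : Nat.Primes) : ℕ)
                    (primesEquiv v : Nat.Primes).2) • D.galAct φ x
                + (((primesEquiv v : Nat.Primes) : ℕ) : HeckeRing0 N 2) • x = 0) →
          ∀ σ : Representation (HeckeRing0 N 2 ⧸ 𝔪) (Field.absoluteGaloisGroup ℚ)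
              (Submodule.torsionBySet (HeckeRing0 N 2) (J0 N) 𝔪),
            (∀ (g : Field.absoluteGaloisGroup ℚ)
                (x : Submodule.torsionBySet (HeckeRing0 N 2) (J0 N) 𝔪) (x' : J0.tors N),
                (x' : J0 N) = x →
                ((σ g x : Submodule.torsionBySet (HeckeRing0 N 2) (J0 N) 𝔪) : J0 N)
                  = ((D.galAct g x' : J0.tors N) : J0 N)) →
            ∃ U : Submodule (HeckeRing0 N 2 ⧸ 𝔪) (Submodule.torsionBySet (HeckeRing0 N 2) (J0 N) 𝔪),
              (∀ (g : Field.absoluteGaloisGroup ℚ), ∀ x ∈ U, σ g x ∈ U) ∧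
              (∀ (g h : Field.absoluteGaloisGroup ℚ), ∀ x ∈ U, σ g (σ h x) = σ h (σ g x)) ∧
              Module.finrank (HeckeRing0 N 2 ⧸ 𝔪)
                (Submodule.torsionBySet (HeckeRing0 N 2) (J0 N) 𝔪 ⧸ U) ≤ 2) :
    buzzard2000_multiplicityOne_gamma0 := by
  refine buzzard2000_multiplicityOne_gamma0_of_galoisData fun N _ hN 𝔪 h𝔪 h2 k _ _ _ _ ι ρ hρ hirr hns => ?_
  -- an embedding `ℚ̄ → ℂ` and the Eichler–Shimura datum there
  haveI : Algebra.IsAlgebraic ℚ (AlgebraicClosure ℚ) := AlgebraicClosure.isAlgebraic ℚ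
  let ιℂ : AlgebraicClosure ℚ →+* ℂ :=
    (IsAlgClosed.lift (R := ℚ) (S := AlgebraicClosure ℚ) (M := ℂ)).toRingHom
  obtain ⟨D, hD⟩ := hES N ιℂ
  have hD2 : ∀ v : HeightOneSpectrum (𝓞 ℚ), ¬ ((primesEquiv v : Nat.Primes) : ℕ) ∣ 2 * N →
      ∀ 𝔓 ∈ v.primesAbove, ∀ φ : Field.absoluteGaloisGroup ℚ, IsArithFrobAt (𝓞 ℚ) φ 𝔓 →
      ∀ x : J0.tors N, (2 : HeckeRing0 N 2) • x = 0 →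
        D.galAct φ (D.galAct φ x)
          - (HeckeRing0.T N 2 ((primesEquiv v : Nat.Primes) : ℕ)
              (primesEquiv v : Nat.Primes).2) • D.galAct φ x
          + (((primesEquiv v : Nat.Primes) : ℕ) : HeckeRing0 N 2) • x = 0 := by
    intro v hv 𝔓 h𝔓 φ hφ x hx
    have hvN : ¬ ((primesEquiv v : Nat.Primes) : ℕ) ∣ N := fun h => hv (dvd_mul_of_dvd_right h 2)
    have hv2 : ¬ ((primesEquiv v : Nat.Primes) : ℕ) ∣ 2 := fun h => hv (dvd_mul_of_dvd_left h N)
    exact hD v hvN 𝔓 h𝔓 φ hφ 2 hv2 x (by exact_mod_cast hx)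
  exact ⟨ιℂ, D, hD2, hJ₁ N hN 𝔪 h𝔪 h2 k ι ρ hρ hirr hns ιℂ D hD2⟩

end Literature.NumberTheory.EllipticCurves.ModularForms

end
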